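import Summits.QuantumFields.YangMills.Theorems.UnitScaleTiltProp7TwistedSliceGaugeOntoSU2OfRegPr
import Summits.QuantumFields.YangMills.Theorems.UnitScaleTiltProp7TwistedSliceGaugeOntoOfRegPr
import HarnessLib

/-!
# Route `UnitScaleTilt`, crux K1 child «MinimiserStabilityRegPr» (stmt-QuantumFields-19200), skeleton v10, stub `stub_existenceMinimalOrbit` (EX), route (α) — **(R-T5) D: THE (P1) SIDE
# OF `hSplitD` IN `𝔰𝔲(2)` CURRENCY, END TO END, FROM PRINTED-REGULAR DATA ONLY**: at `U₀ ∈ 𝔘_k(ε₀)`, `U′ = e^{A₁}U₀ ∈ 𝔘_k(ε₀′)` with `A₁` `𝔰𝔲(2)`-valued, `‖A₁‖ < e·η` (windows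
# `10⁹L²e ≤ 1`, `10¹²L³ε₀ ≤ 1`, `10⁷L³ε₀′ ≤ 1`), every `𝔰𝔲(2)`-valued `ξ` with `QSym(U′)ξ = 0` splits as `ξ = g(ad(−A₁))β′ + (iN′(b₋) − U′(b)·iN′(b₊)·U′(b)⋆)` with `β′` `𝔰𝔲(2)`-VALUED,
# `D(log U̿^{twS})(A₁)β′ = 0`, and `N′` HERMITIAN TRACELESS — the composition ★px6 g0 ✓`Prop7TowerClosenessOfRegPr.exists_slice_tangent_add_gaugeDir_of_QSym_eq_zero_of_regPr` ((P1),
# complex, = ★w5-20520 g6's T5 B with its six tower-closeness rows discharged) ⟶ this seat's ✓`exists_su2_slice_tangent_add_gaugeDir_of_complex_of_regPr` (the θ-average with the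
# trace handled separately, its `1∕8` rows discharged).  NO displayed row remains on the (P1) side; what `hSplitD` still needs is (P2) only (`β′ = Dδ` with `Sl δ` — Landau
# transversality at the chart point, ★px10 g0's LOCATE).

Cell `ym3-torus`, width seat `ym-ust-20520-w4` (gen 6).  THEOREMS ONLY (0 `def`, 0 `sorry`).  `--supports stmt-QuantumFields-19200 --as helper`, count-neutral.  YM₃ on T³ is a ladder
rung (R3), not the Clay problem; nothing here claims the stub, the crux, d = 4 or the mass gap.

WHAT IS PROVED (sorry-free, no definition; ns `…Theorems.Prop7TwistedSliceGaugeOntoSU2`): ★★★`exists_su2_slice_tangent_add_gaugeDir_of_QSym_eq_zero` — binders = ★px6's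
`(hε₀ he hWe hWε hε₀' hε') (U₀ U') (hreg hreg') (A₁) (hA₁) (hU')` + `hA₁R` (`A₁` skew-Hermitian traceless) + `(ξ) (hξR : 𝔰𝔲(2)-valued) (hξ : QSym F n K h U' ξ = 0)`; conclusion = this seat's
✓`exists_su2_slice_tangent_add_gaugeDir_of_complex` conclusion VERBATIM.
HONEST SCOPE.  A two-line composition of landed theorems; (P2) is untouched; nothing of `hSplitD` as displayed (which also carries `Sl δ`∕`D δ`), EX, the crux, N06(d = 3) or the gap is proved.

References: T. Bałaban, CMP **102** (1985) 277–309 [Balaban1985Variational] ((51) p.286, (82)–(83) p.290); CMP **98** (1985) 17–51 [Balaban1985Averaging] ((11) p.19, (89)–(92) p.31, (97) p.32);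
CMP **99** (1985) 389–434 [Balaban1985BackgroundPropagators] ((3.13)–(3.15), (3.19) p.393).
-/

set_option autoImplicit false

noncomputable section

open scoped BigOperators Matrix Matrix.Norms.L2Operator Topology
open Filter Metric Set NormedSpace

namespace Summit.QuantumFields.YangMills.Theorems.Prop7TwistedSliceGaugeOntoSU2

open Literature.Analysis.Calculus.ExpDifferential (ad gSer)
open Literature.MathematicalPhysics.QuantumFieldTheory.Balaban1983to89
open Literature.MathematicalPhysics.QuantumFieldTheory.Balaban1983to89.T3ContinuumYM3Torus
open T3PrintedRegularMinimiser (RegPr)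
open T3SectALandauChart (eta bgUnits)
open Summit.QuantumFields.YangMills.Theorems.Prop7SymAvgTwSym (logChartTwS)
open Summit.QuantumFields.YangMills.Theorems.Prop7SymAvgGL (QSym)
open Summit.QuantumFields.YangMills.Theorems.Prop7TowerClosenessOfRegPr (exists_slice_tangent_add_gaugeDir_of_QSym_eq_zero_of_regPr)

variable (F : T3Family) {n K : ℕ} (h : n ≤ K)

/-- ★★★ **THE (P1) SIDE OF `hSplitD` IN `𝔰𝔲(2)` CURRENCY FROM PRINTED-REGULAR DATA ONLY.**  At `U₀ ∈ 𝔘_k(ε₀)`, `U′ ∈ 𝔘_k(ε₀′)` with `U′(b) = e^{A₁(b)}U₀(b)`, `A₁` skew-Hermitian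
traceless, `‖A₁‖ < e·η` (`10⁹L²e ≤ 1`, `10¹²L³ε₀ ≤ 1`, `10⁷L³ε₀′ ≤ 1`): every skew-Hermitian traceless `ξ` with `QSym(U′)ξ = 0` is
`ξ(b) = g(ad(−A₁ b))(β′ b) + (i·N′(b₋) − U′(b)·(i·N′(b₊))·U′(b)⋆)` with `β′` skew-Hermitian traceless, `D(logChartTwS U₀)(A₁)β′ = 0`, `N′` Hermitian traceless —
★px6 g0's ✓`exists_slice_tangent_add_gaugeDir_of_QSym_eq_zero_of_regPr` (complex pair, tower rows discharged) followed by ✓`exists_su2_slice_tangent_add_gaugeDir_of_complex_of_regPr`.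
[cite: Balaban1985Variational, (51) p.286, (82)-(83) p.290; Balaban1985Averaging, (11) p.19, (97) p.32; Balaban1985BackgroundPropagators, (3.13)-(3.15) p.393] -/
theorem exists_su2_slice_tangent_add_gaugeDir_of_QSym_eq_zero {ε₀ ε₀' e : ℝ} (hε₀ : 0 < ε₀) (he : 0 < e) (hWe : 10 ^ 9 * (F.L : ℝ) ^ 2 * e ≤ 1)
    (hWε : 10 ^ 12 * (F.L : ℝ) ^ 3 * ε₀ ≤ 1) (hε₀' : 0 < ε₀') (hε' : 10 ^ 7 * (F.L : ℝ) ^ 3 * ε₀' ≤ 1)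
    (U₀ U' : GaugeField (F.P K) 0 (Matrix.specialUnitaryGroup (Fin 2) ℂ)) (hreg : RegPr F n K ε₀ U₀) (hreg' : RegPr F n K ε₀' U')
    (A₁ : PBond (F.P K) 0 → Matrix (Fin 2) (Fin 2) ℂ) (hA₁ : ‖A₁‖ < e * eta F n K) (hA₁R : ∀ b, star (A₁ b) = -A₁ b ∧ (A₁ b).trace = 0)
    (hU' : ∀ b, ((U' b : Matrix.specialUnitaryGroup (Fin 2) ℂ) : Matrix (Fin 2) (Fin 2) ℂ) = exp (A₁ b) * ((U₀ b : Matrix.specialUnitaryGroup (Fin 2) ℂ) : Matrix (Fin 2) (Fin 2) ℂ))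
    (ξ : PBond (F.P K) 0 → Matrix (Fin 2) (Fin 2) ℂ) (hξR : ∀ b, star (ξ b) = -ξ b ∧ (ξ b).trace = 0) (hξ : QSym F n K h U' ξ = 0) :
    ∃ β' : PBond (F.P K) 0 → Matrix (Fin 2) (Fin 2) ℂ, (∀ b, star (β' b) = -β' b ∧ (β' b).trace = 0) ∧ fderiv ℂ (logChartTwS F n K h U₀) A₁ β' = 0 ∧
      ∃ N' : Site (F.P K) 0 → Matrix (Fin 2) (Fin 2) ℂ, (∀ x, (N' x).IsHermitian ∧ (N' x).trace = 0) ∧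
        ∀ b : PBond (F.P K) 0, ξ b = gSer ℂ (ad ℂ (-A₁ b)) (β' b)
          + (Complex.I • N' b.src - ((U' b : Matrix.specialUnitaryGroup (Fin 2) ℂ) : Matrix (Fin 2) (Fin 2) ℂ) * (Complex.I • N' b.tgt)
              * star ((U' b : Matrix.specialUnitaryGroup (Fin 2) ℂ) : Matrix (Fin 2) (Fin 2) ℂ)) := by
  obtain ⟨β, N, hβ, hsplit⟩ := exists_slice_tangent_add_gaugeDir_of_QSym_eq_zero_of_regPr F h hε₀ he hWe hWε hε₀' hε' U₀ U' hreg hreg' A₁ hA₁ hU' ξ hξ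
  exact exists_su2_slice_tangent_add_gaugeDir_of_complex_of_regPr F h hε₀ he hWe hWε U₀ hreg hA₁ hA₁R U' ξ hξR β N hβ hsplit

end Summit.QuantumFields.YangMills.Theorems.Prop7TwistedSliceGaugeOntoSU2

end
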